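import Mathlib
import Literature.AlgebraicGeometry.Resolution.RegularLocalOrderValuation
import Literature.AlgebraicGeometry.Resolution.RegularLocalRingsQuotient
import Summits.ResolutionOfSingularities.ResolutionOfSingularities.Theorems.WeightedInvariantHypersurfaceLocalGameEFTDimTwoSteepening
import HarnessLib

/-!
# The contact filtration of a regular parameter and its canonicity (door `HypersurfaceCentreConstruction`, rung P2)

Topic: `Summits/ResolutionOfSingularities/ResolutionOfSingularities/Theorems`. Helper for the door item
`HypersurfaceCentreConstruction` (statement `stmt-ResolutionOfSingularities-19897`, route `WeightedInvariant`),
line `local-engine` of `res-L1-w43-plan-1` (L W4.3), CRUX-PLAN §v7.2 position rung **P2** («positions of dimension ≤ 2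
with ONE explicit `(ι₂, J₂) = (iotaOrd, TERMINAL-STEEPENING weighted filtration)`», order (o24) reserved; risk line
«canonicity of the terminal filtration under wild automorphisms in char p»).  This file is the J-HALF LEMMA of that rung
BY NAME (the twin of res-type-073's ι-half `…IotaOrderStratDimTwo`): it settles the canonicity risk POSITIVELY and
fact-free for the filtrations that the (o13) dim-2 rung (K3–K7) actually uses.  Reserve hand res-type-078 (OFFER +
TAKING-UNLESS-OBJECTED 2026-08-27T07:34:56Z; counted 0; does not pre-empt (o24)).

[OURS · L1 W4.3] Replaces the role of NO printed item; NOT a statement of the manuscript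
[claim: Hironaka2017, status: under-review]. AI work, weaker than expert review.

## Content (no definitions: the CONTACT FILTRATION of `g ∈ 𝔪` with weight `b` is written out as
`⨆ j, (g^j) · 𝔪^{n - b j}` — «the monomials `x^i g^j` with `i + b j ≥ n`» without naming `x`)

* C1 `weightedMonomialIdeal_eq_contactFiltration`: for `(x, g) = 𝔪`, `b ≥ 1`: `weightedMonomialIdeal ![x, g] ![1, b] n =
  ⨆ j, (g^j) 𝔪^{n - bj}` — the `(1,b)`-filtration of the (o13) game does not depend on the transversal parameter `x`.
* C2 **`contactFiltration_eq_of_mem` (CANONICITY)**: in a regular local ring of ANY dimension, if `b ≥ 2`, `f ∉ 𝔪^{ν+1}`,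
  `g₁, g₂ ∈ 𝔪 ∖ 𝔪²` and `f` lies in level `bν` of BOTH contact filtrations, they coincide in every degree (key step
  `mem_span_sup_pow_of_mem_contactFiltration`: `g₁ ∈ (g₂) + 𝔪^b`, reading `f` in the regular local ring `S/(g₂)` where
  `unit · g₁^ν` has order `ν · ord ḡ₁` strictly below every other term unless `ord ḡ₁ ≥ b`).
* C3 `weightedMonomialIdeal_eq_of_mem_of_mem`: the TERMINAL filtration of the steepening process (`…EFTDimTwoSteepening`,
  `…EFTDimTwoContact`) at a dimension-two position is independent of `x`, of the lifts `λ̃`, and of the terminal contact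
  parameter — the candidate `J₂(S, f)` of P2 is choice-free; `b = 1` is the `𝔪`-adic filtration
  (`contactFiltration_one_eq_pow`); unit / iso invariance in the `JUnitInvariant` / `JIsoInvariant` shapes
  (`unit_mul_mem_iff`, `contactFiltration_unit_mul`, `map_contactFiltration_ringEquiv`).

## References

* H. Hironaka, *Characteristic polyhedra of singularities*, J. Math. Kyoto Univ. 7 (1967) 251–293. [Hironaka1967]
* V. Cossart, O. Piltant, *Resolution of singularities of arithmetical threefolds II*, §2. [CossartPiltant2019]
-/

noncomputable section

open IsLocalRing Literature.AlgebraicGeometry.Resolution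

set_option linter.dupNamespace false -- mandated namespace of this single-conjunct summit

namespace Summit.ResolutionOfSingularities.ResolutionOfSingularities.Theorems

namespace ContactFiltration

universe u

variable {S : Type u} [CommRing S]

/-! ### The contact filtration `⨆ j, (g^j) 𝔪^{n - bj}`: elementary inclusions -/

section Basic

variable [IsLocalRing S]

/-- The `j`-th piece lies in the filtration. [folklore] -/
theorem piece_le (g : S) (b n j : ℕ) :
    Ideal.span {g ^ j} * maximalIdeal S ^ (n - b * j) ≤
      ⨆ j, Ideal.span {g ^ j} * maximalIdeal S ^ (n - b * j) :=
  le_iSup (fun j => Ideal.span {g ^ j} * maximalIdeal S ^ (n - b * j)) j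

/-- `g^j · m` with `m ∈ 𝔪^{n - bj}` lies in degree `n`. [folklore] -/
theorem pow_mul_mem (g : S) (b n j : ℕ) {m : S} (hm : m ∈ maximalIdeal S ^ (n - b * j)) :
    g ^ j * m ∈ ⨆ j, Ideal.span {g ^ j} * maximalIdeal S ^ (n - b * j) :=
  piece_le g b n j (Ideal.mul_mem_mul (Ideal.mem_span_singleton_self _) hm)

/-- `𝔪^n` lies in degree `n` (the piece `j = 0`). [folklore] -/
theorem pow_le (g : S) (b n : ℕ) :
    maximalIdeal S ^ n ≤ ⨆ j, Ideal.span {g ^ j} * maximalIdeal S ^ (n - b * j) := by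
  have h := piece_le g b n 0
  rwa [pow_zero, Ideal.span_singleton_one, Ideal.top_mul, mul_zero, Nat.sub_zero] at h

/-- Degree `n` lies in `(g) + 𝔪^n` (the pieces `j ≥ 1` are multiples of `g`). [folklore] -/
theorem le_span_sup_pow (g : S) (b n : ℕ) :
    (⨆ j, Ideal.span {g ^ j} * maximalIdeal S ^ (n - b * j)) ≤ Ideal.span {g} ⊔ maximalIdeal S ^ n := by
  refine iSup_le fun j => ?_
  rcases Nat.eq_zero_or_pos j with rfl | hj
  · rw [pow_zero, Ideal.span_singleton_one, Ideal.top_mul, mul_zero, Nat.sub_zero]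
    exact le_sup_right
  · refine le_trans Ideal.mul_le_right (le_trans ?_ le_sup_left)
    rw [Ideal.span_singleton_le_iff_mem, Ideal.mem_span_singleton]
    exact dvd_pow_self g hj.ne'

/-- For `b = 1` (and `g ∈ 𝔪`) the contact filtration is the `𝔪`-adic one. [folklore] -/
theorem contactFiltration_one_eq_pow {g : S} (hg : g ∈ maximalIdeal S) (n : ℕ) :
    (⨆ j, Ideal.span {g ^ j} * maximalIdeal S ^ (n - 1 * j)) = maximalIdeal S ^ n := by
  refine le_antisymm (iSup_le fun j => ?_) (pow_le g 1 n)
  rw [one_mul]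
  have hgj : Ideal.span {g ^ j} ≤ maximalIdeal S ^ j := by
    rw [Ideal.span_singleton_le_iff_mem]
    exact Ideal.pow_mem_pow hg j
  refine le_trans (Ideal.mul_mono_left hgj) ?_
  rw [← pow_add]
  exact Ideal.pow_le_pow_right (by omega)

/-- UNIT INVARIANCE in the equation (`JUnitInvariant` shape of `…LocalGameEFT3`): `v f` and `f` lie in the same pieces.
[folklore] -/
theorem unit_mul_mem_iff {v : S} (hv : IsUnit v) (f g : S) (b n : ℕ) :
    v * f ∈ (⨆ j, Ideal.span {g ^ j} * maximalIdeal S ^ (n - b * j)) ↔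
      f ∈ ⨆ j, Ideal.span {g ^ j} * maximalIdeal S ^ (n - b * j) :=
  Ideal.unit_mul_mem_iff_mem _ hv

/-- UNIT INVARIANCE in the contact parameter: `v g` and `g` have the same contact filtration. [folklore] -/
theorem contactFiltration_unit_mul {v : S} (hv : IsUnit v) (g : S) (b n : ℕ) :
    (⨆ j, Ideal.span {(v * g) ^ j} * maximalIdeal S ^ (n - b * j)) =
      ⨆ j, Ideal.span {g ^ j} * maximalIdeal S ^ (n - b * j) := by
  refine iSup_congr fun j => ?_
  rw [mul_pow, Ideal.span_singleton_mul_left_unit (hv.pow j)]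

/-- ISO INVARIANCE (`JIsoInvariant` shape of `…LocalGameEFT3`): a ring isomorphism of local rings transports the
contact filtration of `g` to that of `e g`. [folklore] -/
theorem map_contactFiltration_ringEquiv {T : Type u} [CommRing T] [IsLocalRing T] (e : S ≃+* T) (g : S)
    (b n : ℕ) :
    (⨆ j, Ideal.span {g ^ j} * maximalIdeal S ^ (n - b * j)).map e.toRingHom =
      ⨆ j, Ideal.span {e g ^ j} * maximalIdeal T ^ (n - b * j) := by
  rw [Ideal.map_iSup]
  refine iSup_congr fun j => ?_
  rw [Ideal.map_mul, Ideal.map_pow, Ideal.map_span, Set.image_singleton,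
    IsLocalRing.map_maximalIdeal_of_surjective e.toRingHom e.surjective]
  simp

end Basic

/-! ### C1: the weighted filtration of an r.s.p. `(x, g)` is the contact filtration of `g` -/

section Chart

variable [IsLocalRing S]

/-- **C1**: for `(x, g) = 𝔪` and `b ≥ 1`, `weightedMonomialIdeal ![x, g] ![1, b] n = ⨆ j, (g^j) 𝔪^{n - bj}` — the weighted
filtration of the (o13) game does not depend on the transversal parameter `x`. [cite: Hironaka1967, §1] -/
theorem weightedMonomialIdeal_eq_contactFiltration {x g : S} (hxg : Ideal.span {x, g} = maximalIdeal S) {b : ℕ}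
    (hb : 1 ≤ b) (n : ℕ) :
    weightedMonomialIdeal ![x, g] ![1, b] n = ⨆ j, Ideal.span {g ^ j} * maximalIdeal S ^ (n - b * j) := by
  apply le_antisymm
  · rw [weightedMonomialIdeal, Ideal.span_le]
    rintro _ ⟨α, hα, rfl⟩
    simp only [Fin.sum_univ_two, Matrix.cons_val_zero, Matrix.cons_val_one, one_mul] at hα
    rw [Fin.prod_univ_two]
    simp only [Matrix.cons_val_zero, Matrix.cons_val_one, SetLike.mem_coe]
    have hx : x ∈ maximalIdeal S := hxg ▸ Ideal.subset_span (by simp)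
    rw [mul_comm]
    exact pow_mul_mem g b n (α 1) (Ideal.pow_le_pow_right (by omega) (Ideal.pow_mem_pow hx (α 0)))
  · refine iSup_le fun j => ?_
    have h1 : Ideal.span {g ^ j} ≤ weightedMonomialIdeal ![x, g] ![1, b] (b * j) := by
      rw [Ideal.span_singleton_le_iff_mem]
      simpa [Nat.mul_comm] using
        pow_mem_weightedMonomialIdeal ![x, g] ![1, b] (LocalGameEFTSteepening.snd_mem x g b) j
    have h2 : maximalIdeal S ^ (n - b * j) ≤ weightedMonomialIdeal ![x, g] ![1, b] (n - b * j) := by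
      rw [← hxg]
      exact LocalGameEFTSteepening.span_pair_pow_le x g hb _
    refine le_trans (Ideal.mul_mono h1 h2) (le_trans (weightedMonomialIdeal_mul_le ![x, g] ![1, b] _ _) ?_)
    exact weightedMonomialIdeal_antitone _ _ (by omega)

/-- **Independence of the transversal parameter**: two regular systems `(x₁, g)`, `(x₂, g)` with the same contact
parameter `g` define the same `(1, b)`-weighted filtration. [cite: Hironaka1967, §1] -/
theorem weightedMonomialIdeal_pair_eq_of_snd_eq {x₁ x₂ g : S} (h₁ : Ideal.span {x₁, g} = maximalIdeal S)
    (h₂ : Ideal.span {x₂, g} = maximalIdeal S) {b : ℕ} (hb : 1 ≤ b) (n : ℕ) :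
    weightedMonomialIdeal ![x₁, g] ![1, b] n = weightedMonomialIdeal ![x₂, g] ![1, b] n := by
  rw [weightedMonomialIdeal_eq_contactFiltration h₁ hb, weightedMonomialIdeal_eq_contactFiltration h₂ hb]

end Chart

/-! ### C2: canonicity of the contact filtration -/

section Canonical

variable [IsRegularLocalRing S]

/-- Comparison of two contact parameters: `g₁ ∈ (g₂) + 𝔪^b` transfers the filtration of `g₁` into that of `g₂`.
[folklore] -/
theorem contactFiltration_le_of_mem_span_sup_pow {g₁ g₂ : S} {b : ℕ}
    (h : g₁ ∈ Ideal.span {g₂} ⊔ maximalIdeal S ^ b) (n : ℕ) :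
    (⨆ j, Ideal.span {g₁ ^ j} * maximalIdeal S ^ (n - b * j)) ≤
      ⨆ j, Ideal.span {g₂ ^ j} * maximalIdeal S ^ (n - b * j) := by
  -- `(g₁^j) ⊆ ⨆_{i ≤ j} (g₂^i) 𝔪^{b(j-i)}`
  have hpow : ∀ j : ℕ, Ideal.span {g₁ ^ j} ≤ ⨆ i, Ideal.span {g₂ ^ i} * maximalIdeal S ^ (b * j - b * i) := by
    intro j
    induction j with
    | zero =>
      refine le_trans ?_ (le_iSup (fun i => Ideal.span {g₂ ^ i} * maximalIdeal S ^ (b * 0 - b * i)) 0)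
      simp
    | succ j ih =>
      have hg₁ : Ideal.span {g₁} ≤ Ideal.span {g₂} ⊔ maximalIdeal S ^ b := by
        rwa [Ideal.span_singleton_le_iff_mem]
      rw [pow_succ, ← Ideal.span_singleton_mul_span_singleton]
      refine le_trans (Ideal.mul_mono ih hg₁) ?_
      rw [Ideal.iSup_mul]
      refine iSup_le fun i => ?_
      rw [Ideal.mul_sup]
      refine sup_le ?_ ?_
      · -- `(g₂^i) 𝔪^{bj-bi} · (g₂) ⊆ (g₂^{i+1}) 𝔪^{b(j+1) - b(i+1)}`
        refine le_trans ?_ (le_iSup (fun i => Ideal.span {g₂ ^ i} * maximalIdeal S ^ (b * (j + 1) - b * i)) (i + 1))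
        rw [mul_right_comm, Ideal.span_singleton_mul_span_singleton, ← pow_succ]
        exact Ideal.mul_mono_right (Ideal.pow_le_pow_right (by
          simp only [Nat.mul_succ]
          omega))
      · -- `(g₂^i) 𝔪^{bj-bi} · 𝔪^b ⊆ (g₂^i) 𝔪^{b(j+1) - bi}`
        refine le_trans ?_ (le_iSup (fun i => Ideal.span {g₂ ^ i} * maximalIdeal S ^ (b * (j + 1) - b * i)) i)
        rw [mul_assoc, ← pow_add]
        exact Ideal.mul_mono_right (Ideal.pow_le_pow_right (by
          simp only [Nat.mul_succ]
          omega))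
  refine iSup_le fun j => ?_
  refine le_trans (Ideal.mul_mono_left (hpow j)) ?_
  rw [Ideal.iSup_mul]
  refine iSup_le fun i => le_trans ?_ (piece_le g₂ b n i)
  rw [mul_assoc, ← pow_add]
  exact Ideal.mul_mono_right (Ideal.pow_le_pow_right (by omega))

/-- Powers in a regular local ring: `a ∉ 𝔪^{t+1}` implies `a^ν ∉ 𝔪^{νt+1}` (the order is a valuation).
[cite: ZariskiSamuel1960, Ch. VIII §1 Thm. 1] -/
theorem pow_not_mem_pow_of_not_mem_pow {a : S} {t : ℕ} (ha : a ∉ maximalIdeal S ^ (t + 1)) (ν : ℕ) :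
    a ^ ν ∉ maximalIdeal S ^ (ν * t + 1) := by
  induction ν with
  | zero =>
    rw [pow_zero, zero_mul, zero_add, pow_one]
    exact fun h => (IsLocalRing.maximalIdeal.isMaximal S).ne_top (Ideal.eq_top_of_isUnit_mem _ h isUnit_one)
  | succ ν ih =>
    have h := mul_not_mem_pow_of_not_mem_pow ih ha
    rw [show (ν + 1) * t + 1 = ν * t + t + 1 by ring, pow_succ a ν]
    exact h

/-- **Key step of C2**: let `S` be a regular local ring, `b ≥ 2`, `1 ≤ ν`, `f ∉ 𝔪^{ν+1}`, `g₁ ∈ 𝔪`, `g₂ ∈ 𝔪 ∖ 𝔪²`, and suppose `f`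
lies in degree `bν` of the contact filtrations of BOTH `g₁` and `g₂`.  Then `g₁ ∈ (g₂) + 𝔪^b`.
Proof: in the regular local ring `D = S/(g₂)`, `f̄ ∈ 𝔪_D^{bν}`; writing `f = c g₁^ν + f'` with `c` a unit (forced by
`f ∉ 𝔪^{ν+1}`, `b ≥ 2`) and `f'` in the lower pieces, if `t = ord_D(ḡ₁) < b` then every term of `f̄'` has order
`≥ tν + 1` while `c̄ ḡ₁^ν` has order exactly `tν < bν` — impossible. [cite: Hironaka1967, Thm. (well-preparedness)] -/
theorem mem_span_sup_pow_of_mem_contactFiltration {g₁ g₂ : S} (hg₁ : g₁ ∈ maximalIdeal S)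
    (hg₂ : g₂ ∈ maximalIdeal S) (hg₂' : g₂ ∉ maximalIdeal S ^ 2) {b : ℕ} (hb : 2 ≤ b) {f : S} {ν : ℕ} (hν : 1 ≤ ν)
    (hford : f ∉ maximalIdeal S ^ (ν + 1))
    (h₁ : f ∈ ⨆ j, Ideal.span {g₁ ^ j} * maximalIdeal S ^ (b * ν - b * j))
    (h₂ : f ∈ ⨆ j, Ideal.span {g₂ ^ j} * maximalIdeal S ^ (b * ν - b * j)) :
    g₁ ∈ Ideal.span {g₂} ⊔ maximalIdeal S ^ b := by
  classical
  -- the quotient `D = S/(g₂)`, a regular local ring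
  haveI hD : IsRegularLocalRing (S ⧸ Ideal.span {g₂}) := (IsRegularLocalRing.quotient_span_singleton hg₂ hg₂').1
  set mk : S →+* S ⧸ Ideal.span {g₂} := Ideal.Quotient.mk (Ideal.span {g₂}) with hmk
  have hmkmax : (maximalIdeal S).map mk = maximalIdeal (S ⧸ Ideal.span {g₂}) :=
    IsLocalRing.map_maximalIdeal_of_surjective mk Ideal.Quotient.mk_surjective
  have hcomap : ∀ k : ℕ, (maximalIdeal (S ⧸ Ideal.span {g₂}) ^ k).comap mk = Ideal.span {g₂} ⊔ maximalIdeal S ^ k :=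
    fun k => by
      rw [← hmkmax, ← Ideal.map_pow, Ideal.comap_map_of_surjective mk Ideal.Quotient.mk_surjective,
        ← RingHom.ker_eq_comap_bot, hmk, Ideal.mk_ker, sup_comm]
  -- if `g₁ ∈ (g₂)` we are done
  by_cases hzero : mk g₁ = 0
  · rw [Ideal.Quotient.eq_zero_iff_mem] at hzero
    exact Ideal.mem_sup_left hzero
  -- the order `t` of `ḡ₁`
  obtain ⟨t, ht⟩ := ENat.ne_top_iff_exists.mp (adicOrder_ne_top hzero)
  have htmem : mk g₁ ∈ maximalIdeal (S ⧸ Ideal.span {g₂}) ^ t := (le_adicOrder_iff _ _).mp ht.le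
  have htnot : mk g₁ ∉ maximalIdeal (S ⧸ Ideal.span {g₂}) ^ (t + 1) := (adicOrder_le_iff _ _).mp ht.ge
  by_cases htb : b ≤ t
  · rw [← hcomap b, Ideal.mem_comap]
    exact Ideal.pow_le_pow_right htb htmem
  exfalso
  push Not at htb
  -- `f = a + f'`, `a ∈ (g₁^ν)`, `f'` in the lower pieces `I'`
  set I' : Ideal S := (⨆ j, ⨆ (_ : j < ν), Ideal.span {g₁ ^ j} * maximalIdeal S ^ (b * ν - b * j)) ⊔
    Ideal.span {g₁ ^ ν} * maximalIdeal S with hI'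
  have hsplit : (⨆ j, Ideal.span {g₁ ^ j} * maximalIdeal S ^ (b * ν - b * j)) ≤ Ideal.span {g₁ ^ ν} ⊔ I' := by
    refine iSup_le fun j => ?_
    by_cases hj : j < ν
    · refine le_trans ?_ le_sup_right
      rw [hI']
      refine le_trans ?_ le_sup_left
      exact le_trans (le_iSup (fun _ : j < ν => Ideal.span {g₁ ^ j} * maximalIdeal S ^ (b * ν - b * j)) hj)
        (le_iSup (fun j => ⨆ (_ : j < ν), Ideal.span {g₁ ^ j} * maximalIdeal S ^ (b * ν - b * j)) j)
    · push Not at hj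
      refine le_trans Ideal.mul_le_right (le_trans ?_ le_sup_left)
      rw [Ideal.span_singleton_le_iff_mem, Ideal.mem_span_singleton]
      exact pow_dvd_pow g₁ hj
  have hI'le : I' ≤ maximalIdeal S ^ (ν + 1) := by
    rw [hI']
    refine sup_le (iSup_le fun j => iSup_le fun hj => ?_) ?_
    · have h1 : Ideal.span {g₁ ^ j} ≤ maximalIdeal S ^ j := by
        rw [Ideal.span_singleton_le_iff_mem]; exact Ideal.pow_mem_pow hg₁ j
      refine le_trans (Ideal.mul_mono_left h1) ?_
      rw [← pow_add]
      refine Ideal.pow_le_pow_right ?_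
      have e1 : b * ν - b * j = b * (ν - j) := (mul_tsub b ν j).symm
      have e2 : 2 * (ν - j) ≤ b * (ν - j) := Nat.mul_le_mul_right _ hb
      rw [e1]
      omega
    · have h1 : Ideal.span {g₁ ^ ν} ≤ maximalIdeal S ^ ν := by
        rw [Ideal.span_singleton_le_iff_mem]; exact Ideal.pow_mem_pow hg₁ ν
      refine le_trans (Ideal.mul_mono_left h1) ?_
      rw [pow_succ]
  obtain ⟨a, ha, f', hf', haf⟩ := Submodule.mem_sup.mp (hsplit h₁)
  obtain ⟨c, rfl⟩ := Ideal.mem_span_singleton'.mp ha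
  -- `c` is a unit
  have hc : IsUnit c := by
    by_contra hcu
    have hcm : c ∈ maximalIdeal S := (IsLocalRing.mem_maximalIdeal _).mpr hcu
    apply hford
    rw [← haf]
    refine Ideal.add_mem _ ?_ (hI'le hf')
    have : c * g₁ ^ ν ∈ Ideal.span {g₁ ^ ν} * maximalIdeal S :=
      Submodule.mul_mem_mul_rev (Ideal.mem_span_singleton_self _) hcm
    exact hI'le (by rw [hI']; exact Ideal.mem_sup_right this)
  -- in `D`: `f̄ ∈ 𝔪_D^{bν} ⊆ 𝔪_D^{tν+1}` and `f̄' ∈ 𝔪_D^{tν+1}`, hence `c̄ ḡ₁^ν ∈ 𝔪_D^{tν+1}` — contradiction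
  have htν : ν * t + 1 ≤ b * ν := by
    have := Nat.mul_le_mul_left ν htb
    rw [Nat.mul_succ] at this
    rw [Nat.mul_comm b]
    omega
  have hfD : mk f ∈ maximalIdeal (S ⧸ Ideal.span {g₂}) ^ (ν * t + 1) := by
    refine Ideal.pow_le_pow_right htν ?_
    rw [← Ideal.mem_comap, hcomap]
    exact le_span_sup_pow g₂ b (b * ν) (by simpa [Nat.mul_comm] using h₂)
  have hI'D : I'.map mk ≤ maximalIdeal (S ⧸ Ideal.span {g₂}) ^ (ν * t + 1) := by
    rw [hI', Ideal.map_sup, Ideal.map_iSup]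
    refine sup_le (iSup_le fun j => ?_) ?_
    · rw [Ideal.map_iSup]
      refine iSup_le fun hj => ?_
      rw [Ideal.map_mul, Ideal.map_pow, hmkmax, Ideal.map_span, Set.image_singleton, map_pow]
      have h1 : Ideal.span {mk g₁ ^ j} ≤ maximalIdeal (S ⧸ Ideal.span {g₂}) ^ (t * j) := by
        rw [Ideal.span_singleton_le_iff_mem, pow_mul]
        exact Ideal.pow_mem_pow htmem j
      refine le_trans (Ideal.mul_mono_left h1) ?_
      rw [← pow_add]
      refine Ideal.pow_le_pow_right ?_
      -- `t j + b(ν - j) ≥ t j + (t+1)(ν - j) = t ν + (ν - j) ≥ ν t + 1`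
      have e1 : b * ν - b * j = b * (ν - j) := (mul_tsub b ν j).symm
      have h3 : (t + 1) * (ν - j) ≤ b * (ν - j) := Nat.mul_le_mul_right _ htb
      have h4 : t * j + t * (ν - j) = t * ν := by rw [← Nat.mul_add, Nat.add_sub_cancel' hj.le]
      have h5 : (t + 1) * (ν - j) = t * (ν - j) + (ν - j) := by ring
      have h6 : ν * t = t * ν := Nat.mul_comm _ _
      rw [e1]
      omega
    · rw [Ideal.map_mul, hmkmax, Ideal.map_span, Set.image_singleton, map_pow, pow_succ]
      refine Ideal.mul_mono_left ?_
      rw [Ideal.span_singleton_le_iff_mem, Nat.mul_comm, pow_mul]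
      exact Ideal.pow_mem_pow htmem ν
  have hcg : mk (c * g₁ ^ ν) ∈ maximalIdeal (S ⧸ Ideal.span {g₂}) ^ (ν * t + 1) := by
    have : mk (c * g₁ ^ ν) = mk f - mk f' := by rw [← haf, map_add, add_sub_cancel_right]
    rw [this]
    exact Ideal.sub_mem _ hfD (hI'D (Ideal.mem_map_of_mem mk hf'))
  have hgν : mk g₁ ^ ν ∈ maximalIdeal (S ⧸ Ideal.span {g₂}) ^ (ν * t + 1) := by
    rw [map_mul, map_pow] at hcg
    obtain ⟨u, hu⟩ := hc.map mk
    have := Ideal.mul_mem_left _ (↑u⁻¹ : S ⧸ Ideal.span {g₂}) hcg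
    rwa [← mul_assoc, ← hu, Units.inv_mul, one_mul] at this
  exact pow_not_mem_pow_of_not_mem_pow htnot ν hgν

/-- **C2 — CANONICITY OF THE CONTACT FILTRATION**: in a regular local ring `S` (any dimension), let `b ≥ 2`, `1 ≤ ν`,
`f ∉ 𝔪^{ν+1}`, and `g₁, g₂ ∈ 𝔪 ∖ 𝔪²` two contact parameters which both carry `f` to level `bν`
(`f ∈ ⨆ j, (g_i^j) 𝔪^{bν - bj}`, `i = 1, 2`).  Then the two contact filtrations agree in EVERY degree.
[cite: Hironaka1967, Thm. (well-preparedness)] [cite: CossartPiltant2019, §2] -/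
theorem contactFiltration_eq_of_mem {g₁ g₂ : S} (hg₁ : g₁ ∈ maximalIdeal S) (hg₁' : g₁ ∉ maximalIdeal S ^ 2)
    (hg₂ : g₂ ∈ maximalIdeal S) (hg₂' : g₂ ∉ maximalIdeal S ^ 2) {b : ℕ} (hb : 2 ≤ b) {f : S} {ν : ℕ}
    (hν : 1 ≤ ν) (hford : f ∉ maximalIdeal S ^ (ν + 1))
    (h₁ : f ∈ ⨆ j, Ideal.span {g₁ ^ j} * maximalIdeal S ^ (b * ν - b * j))
    (h₂ : f ∈ ⨆ j, Ideal.span {g₂ ^ j} * maximalIdeal S ^ (b * ν - b * j)) (n : ℕ) :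
    (⨆ j, Ideal.span {g₁ ^ j} * maximalIdeal S ^ (n - b * j)) =
      ⨆ j, Ideal.span {g₂ ^ j} * maximalIdeal S ^ (n - b * j) :=
  le_antisymm
    (contactFiltration_le_of_mem_span_sup_pow
      (mem_span_sup_pow_of_mem_contactFiltration hg₁ hg₂ hg₂' hb hν hford h₁ h₂) n)
    (contactFiltration_le_of_mem_span_sup_pow
      (mem_span_sup_pow_of_mem_contactFiltration hg₂ hg₁ hg₁' hb hν hford h₂ h₁) n)

/-- **C3 — the terminal weighted filtration of the dimension-two game is choice-free**: two regular systems of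
parameters `(x₁, y₁)`, `(x₂, y₂)` of a two-dimensional regular local ring which both carry `f` (`f ∉ 𝔪^{ν+1}`, `ν ≥ 1`)
to the same level `b ≥ 2` of their `(1, b)`-weighted filtrations define the SAME filtration:
`weightedMonomialIdeal ![x₁, y₁] ![1, b] = weightedMonomialIdeal ![x₂, y₂] ![1, b]`.  So the candidate `J₂(S, f)` of rung
P2 — the filtration at the maximal level reached by any contact parameter — involves no choice of coordinates or of
lifts in the steepening process. [cite: Hironaka1967, Thm. (well-preparedness)] -/
theorem weightedMonomialIdeal_eq_of_mem_of_mem (hdim : ringKrullDim S = (2 : ℕ)) {x₁ y₁ x₂ y₂ : S}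
    (h₁ : Ideal.span {x₁, y₁} = maximalIdeal S) (h₂ : Ideal.span {x₂, y₂} = maximalIdeal S) {b : ℕ} (hb : 2 ≤ b)
    {f : S} {ν : ℕ} (hν : 1 ≤ ν) (hford : f ∉ maximalIdeal S ^ (ν + 1))
    (hf₁ : f ∈ weightedMonomialIdeal ![x₁, y₁] ![1, b] (b * ν))
    (hf₂ : f ∈ weightedMonomialIdeal ![x₂, y₂] ![1, b] (b * ν)) (n : ℕ) :
    weightedMonomialIdeal ![x₁, y₁] ![1, b] n = weightedMonomialIdeal ![x₂, y₂] ![1, b] n := by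
  have hb1 : 1 ≤ b := by omega
  have hy₁ : y₁ ∈ maximalIdeal S := h₁ ▸ Ideal.subset_span (by simp)
  have hy₂ : y₂ ∈ maximalIdeal S := h₂ ▸ Ideal.subset_span (by simp)
  have hy₁' := (LocalGameEFTSteepening.not_mem_sq_of_span_pair_eq hdim h₁).2
  have hy₂' := (LocalGameEFTSteepening.not_mem_sq_of_span_pair_eq hdim h₂).2
  rw [weightedMonomialIdeal_eq_contactFiltration h₁ hb1] at hf₁
  rw [weightedMonomialIdeal_eq_contactFiltration h₂ hb1] at hf₂
  rw [weightedMonomialIdeal_eq_contactFiltration h₁ hb1, weightedMonomialIdeal_eq_contactFiltration h₂ hb1]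
  exact contactFiltration_eq_of_mem hy₁ hy₁' hy₂ hy₂' hb hν hford hf₁ hf₂ n

end Canonical

end ContactFiltration

end Summit.ResolutionOfSingularities.ResolutionOfSingularities.Theorems

end
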